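import Summits.CriticalPhenomena.PercolationContinuityZ3.Theorems.SahiMasterFamilyOrShapeSq
import Summits.CriticalPhenomena.PercolationContinuityZ3.Theorems.PercNearOneGluingNoHeavyLowerTailSahiCombCopyKernel

/-!
# The OR-shape at every order, I: Sahi's generating function along one coordinate

Unit `prim-master-conj` (crux anchor stmt-CriticalPhenomena-4575, helper work), gen 17; memo
`run/shared/lean/prim/prim-l12/prim-master-conj/POINTWISE.md` §18.  Order-3 ancestor: gen 15's identity (B)
(`Pointwise.sahiE_three_unionCoord_two_free`); order 4: gen 16's `Pinning.sahiE_four_orThree_nonneg`.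

SETTING.  `p` a point of the closed cube, `e` a coordinate, `t = p_e`, `s = 1 − t`; `A` ANY event (sections `A⁰ = secAt e false A`,
`A¹ = secAt e true A`), `B_0,…,B_n` events that are `e`-FREE (`secAt e b (B j) = B j`), and the OR-shape family
`U = (A, B_0 ∪ S_e, …, B_n ∪ S_e)`, `S_e = {ω | e ∈ ω}` (every increasing event containing `S_e` has this form).
Write `μ⁰ = μ_{p[e↦0]}`, `μ¹ = μ_{p[e↦1]}` (so `μ_p = s·μ⁰ + t·μ¹` pointwise, `bernoulliWeight_eq_sections`).  In the tree's square-free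
algebra `ℝ[x_0,…,x_n]/(x_j²)` (`SqFree`, [Sahi2008, §3.3]; `binomB c u = (1−u)^c`, `inv1 u = (1−u)⁻¹`) put
`X_ω = Σ_j x_j·1_{B_j}(ω)` (`= lin (ind ∘ B) ω`), `σ = Σ_j x_j`, and `Ĝ = ∏_ω (1 − X_ω)^{s·μ⁰(ω)}`.

MAIN RESULT (`sahiE_orShape_eq_coeff`): Sahi's functional of the OR-shape family is the top square-free coefficient

  `E_{n+2}(μ_p; 1_U) = [x^{univ}] Ĝ · (1−σ)^t · ( s·Σ_ω μ⁰(ω)·1_{A⁰}(ω)·(1−X_ω)⁻¹ + t·μ_p(A¹)·(1−σ)⁻¹ )`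

— Sahi's Proposition 12 [Sahi2008, Prop. 12; tree `sahiE_eq_gfE`] for `μ_p`, the head slot extracted to first order
(`gfE_cons_eq_sum_coeff`, the tree's computation inside `gfE_cons` isolated as a lemma), and the product over configurations split
along `μ_p = s·μ⁰ + t·μ¹` (`∏_ω (1−σ)^{t·μ¹(ω)} = (1−σ)^t`).  Part II (`…OrShapeMerged`) expresses the merged-block expansion
`Σ_π Π_{C∈π} ψ_{|C|}(s)·E_{|π|+1}(μ_p; 1_{A⁰}, (1_{B_C})_{C∈π})` as a coefficient of the same kind and proves the domination theorem.
Square-free plumbing: `…OrShapeSq`.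
HONEST FRAMING: identities only; nothing is asserted about `C_k` / `MasterFamilyEqIff k`.  Axioms standard. [this work]
-/

set_option autoImplicit false

open Finset

open private SqFree.ext coeff_add coeff_sub coeff_one coeff_mul coeff_sum coeff_single coeff_C_mul coeff_C coeff_neg
  isNil_single isNil_lin IsNil.add IsNil.sub IsNil.mul_left IsNil.neg IsNil.sum IsNil.emb
  binomB_mul_binomB binomB_mul_binomB_same binomB_one_sub_binomB isNil_one_sub_binomB coeff_empty_binomB
  binomB_zero_right binomB_zero_left binomB_one_left binomB_sub_one prod_binomB_eq_binomB_sum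
  prod_binomB_add_sqzero lin_cons emb_binomB emb_inv1 coeff_univ_single_zero_mul_emb coeff_emb_univ
  C_mul_single single_mul_single_self one_sub_mul_inv1 inv1_mul_one_sub mul_inv1 C_apply rch_one
  from Literature.Combinatorics.Sahi2008.CumulationCone

noncomputable section

open scoped Classical

namespace Summit.CriticalPhenomena.PercolationContinuityZ3.Theorems

namespace OrShape

open Function
open Literature.Combinatorics.Sahi2008
open Literature.Combinatorics.Sahi2008.SqFree
open Literature.Probability.Percolation.DecisionTree (ind ind_of_mem ind_of_not_mem ind_nonneg)

/-! ### One coordinate: `μ_p = (1 − p_e)·μ_{p[e↦0]} + p_e·μ_{p[e↦1]}` and the two half-cubes -/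

section Weights

variable {ι : Type} [Fintype ι]

/-- **Splitting the product weight along the coordinate `e`**: `μ_p(ω) = (1 − p_e)·μ_{p[e↦0]}(ω) + p_e·μ_{p[e↦1]}(ω)` for every
configuration `ω`. [folklore] -/
theorem bernoulliWeight_eq_sections (p : ι → unitInterval) (e : ι) (ω : Set ι) :
    bernoulliWeight p ω = (1 - (p e : ℝ)) * bernoulliWeight (update p e 0) ω + (p e : ℝ) * bernoulliWeight (update p e 1) ω := by
  by_cases he : e ∈ ω
  · have hω : ω = insert e (ω \ {e}) := by rw [Set.insert_sdiff_singleton, Set.insert_eq_of_mem he]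
    have he' : e ∉ ω \ {e} := fun h => h.2 rfl
    rw [hω]
    have h := (bernoulliWeight_update p e (p e) he').1
    rw [update_eq_self] at h
    rw [h, (bernoulliWeight_update p e 0 he').1, (bernoulliWeight_update p e 1 he').1]
    simp
  · have h := (bernoulliWeight_update p e (p e) he).2
    rw [update_eq_self] at h
    rw [h, (bernoulliWeight_update p e 0 he).2, (bernoulliWeight_update p e 1 he).2]
    simp

/-- `μ_{p[e↦0]}` lives on `{e ∉ ω}`. [folklore] -/
theorem bernoulliWeight_update_zero_eq_zero (p : ι → unitInterval) (e : ι) {ω : Set ι} (he : e ∈ ω) :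
    bernoulliWeight (update p e 0) ω = 0 := by
  have hω : ω = insert e (ω \ {e}) := by rw [Set.insert_sdiff_singleton, Set.insert_eq_of_mem he]
  have he' : e ∉ ω \ {e} := fun h => h.2 rfl
  rw [hω, (bernoulliWeight_update p e 0 he').1]
  simp

/-- `μ_{p[e↦1]}` lives on `{e ∈ ω}`. [folklore] -/
theorem bernoulliWeight_update_one_eq_zero (p : ι → unitInterval) (e : ι) {ω : Set ι} (he : e ∉ ω) :
    bernoulliWeight (update p e 1) ω = 0 := by
  rw [(bernoulliWeight_update p e 1 he).2]
  simp

omit [Fintype ι] in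
/-- Off `e`, `B ∪ {e∈ω}` is `B`. [folklore] -/
theorem ind_union_coord_of_not_mem (e : ι) (B : Set (Set ι)) {ω : Set ι} (he : e ∉ ω) :
    ind (B ∪ {ω' : Set ι | e ∈ ω'}) ω = ind B ω := by
  simp only [ind, Set.mem_union, Set.mem_setOf_eq, he, or_false]

omit [Fintype ι] in
/-- On `e`, `B ∪ {e∈ω}` is sure. [folklore] -/
theorem ind_union_coord_of_mem (e : ι) (B : Set (Set ι)) {ω : Set ι} (he : e ∈ ω) :
    ind (B ∪ {ω' : Set ι | e ∈ ω'}) ω = 1 := by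
  simp only [ind, Set.mem_union, Set.mem_setOf_eq, he, or_true, if_true]

/-- Expectations of `e`-free indicators do not depend on `p_e`. [folklore] -/
theorem ex_ind_update_of_free (p : ι → unitInterval) (e : ι) (s' : unitInterval) {X : Set (Set ι)} (hX : secAt e false X = X) :
    ex (bernoulliWeight (update p e s')) (ind X) = ex (bernoulliWeight p) (ind X) := by
  have h := ex_ind_secAt_update p e false X s'
  rwa [hX] at h

/-- Sahi functionals of `e`-free indicator families do not depend on `p_e`, every order. [folklore] -/
theorem sahiE_ind_update_of_free (p : ι → unitInterval) (e : ι) (s' : unitInterval) {k : ℕ} {F : Fin k → Set (Set ι)}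
    (hF : ∀ j, secAt e false (F j) = F j) :
    sahiE (bernoulliWeight (update p e s')) k (fun j => ind (F j)) = sahiE (bernoulliWeight p) k (fun j => ind (F j)) := by
  have h := sahiE_secAt_update_eq p e false s' (p e) F
  simp only [hF, update_eq_self] at h
  exact h

end Weights

/-! ### The head slot to first order: `E_{n+2}(f, g) = Σ_x μ(x) f(x)·[t^univ] Z_g·(1 − L_g(x))⁻¹` -/

section Head

variable {α : Type*} [Fintype α]

/-- **Extraction of the head slot** (the first step of the tree's `gfE_cons`, isolated): for ANY weight `μ`,
`gfE μ (n+2) (f, g) = Σ_x μ(x) f(x) · [t^{univ}]( ∏_y (1 − L_g(y))^{μ(y)} · (1 − L_g(x))⁻¹ )`, `L_g(x) = Σ_i t_i g_i(x)`.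
[cite: Sahi2008, Prop. 12 (p. 219); tree `gfE_cons`] -/
theorem gfE_cons_eq_sum_coeff (μ : α → ℝ) (n : ℕ) (f : α → ℝ) (g : Fin (n + 1) → α → ℝ) :
    gfE μ (n + 2) (Matrix.vecCons f g) =
      ∑ x, μ x * f x * ((∏ y, binomB (μ y) (lin g y)) * inv1 (lin g x)).coeff univ := by
  set u : α → SqFree (Fin (n + 1)) ℝ := fun x => lin g x with hu_def
  have hu : ∀ x, (u x).IsNil := fun x => isNil_lin g x
  set Z : SqFree (Fin (n + 1)) ℝ := ∏ x, binomB (μ x) (u x) with hZ_def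
  have hl : ∀ x ∈ (univ : Finset α),
      binomB (μ x) (lin (Matrix.vecCons f g) x) = binomB (μ x) (emb (u x) + single {0} (f x)) := by
    intro x _
    rw [lin_cons]
    congr 1
    exact add_comm _ _
  have hP : ∏ x, binomB (μ x) (emb (u x)) = emb Z := by
    rw [hZ_def, map_prod]
    exact Finset.prod_congr rfl fun x _ => (emb_binomB (hu x) (μ x)).symm
  rw [gfE, Finset.prod_congr rfl hl,
    prod_binomB_add_sqzero univ μ (fun x => emb (u x)) (fun x => single {0} (f x))
      (fun x => IsNil.emb (hu x)) (fun x => isNil_single (singleton_nonempty _) _)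
      (fun x y => single_mul_single_self (singleton_nonempty _) _ _), hP]
  have : (1 : SqFree (Fin (n + 2)) ℝ) - emb Z * (1 - ∑ x, C (μ x) * single {0} (f x) * inv1 (emb (u x)))
      = (1 - emb Z) + ∑ x, emb Z * (C (μ x) * single {0} (f x) * inv1 (emb (u x))) := by
    rw [mul_sub, mul_one, Finset.mul_sum]; ring
  rw [this, coeff_add, coeff_sub, coeff_one, if_neg (Finset.univ_nonempty.ne_empty), coeff_emb_univ,
    sub_zero, zero_add, coeff_sum]
  refine Finset.sum_congr rfl fun x _ => ?_
  rw [← emb_inv1 (hu x), C_mul_single]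
  have : emb Z * (single {0} (μ x * f x) * emb (inv1 (u x)))
      = single {0} (μ x * f x) * emb (Z * inv1 (u x)) := by
    rw [map_mul]; ring
  rw [this, coeff_univ_single_zero_mul_emb]

/-- The same for `sahiE` under a probability weight. [cite: Sahi2008, Prop. 12 (p. 219)] -/
theorem sahiE_cons_eq_sum_coeff (μ : α → ℝ) (hμ : ∑ x, μ x = 1) (n : ℕ) (f : α → ℝ) (g : Fin (n + 1) → α → ℝ) :
    sahiE μ (n + 2) (Matrix.vecCons f g) =
      ∑ x, μ x * f x * ((∏ y, binomB (μ y) (lin g y)) * inv1 (lin g x)).coeff univ := by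
  rw [sahiE_eq_gfE μ hμ, gfE_cons_eq_sum_coeff]

end Head

/-! ### The OR-shape family: the product over configurations along `μ_p = s·μ⁰ + t·μ¹` -/

section OrFamily

variable {ι : Type} [Fintype ι] (p : ι → unitInterval) (e : ι) {n : ℕ} (A : Set (Set ι)) (B : Fin (n + 1) → Set (Set ι))

omit [Fintype ι] in
/-- The linear form of the OR-shape tail off `e` is `X_ω = Σ_j x_j 1_{B_j}(ω)`. [this work] -/
theorem lin_orTail_of_not_mem {ω : Set ι} (he : e ∉ ω) :
    lin (fun j => ind (B j ∪ {ω' : Set ι | e ∈ ω'})) ω = lin (fun j => ind (B j)) ω := by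
  unfold SqFree.lin
  exact Finset.sum_congr rfl fun j _ => by simp only [ind_union_coord_of_not_mem e (B j) he]

omit [Fintype ι] in
/-- The linear form of the OR-shape tail on `e` is `σ = Σ_j x_j`. [this work] -/
theorem lin_orTail_of_mem {ω : Set ι} (he : e ∈ ω) :
    lin (fun j => ind (B j ∪ {ω' : Set ι | e ∈ ω'})) ω = ∑ j : Fin (n + 1), single ({j} : Finset (Fin (n + 1))) (1 : ℝ) := by
  unfold SqFree.lin
  exact Finset.sum_congr rfl fun j _ => by simp only [ind_union_coord_of_mem e (B j) he]

/-- `σ = Σ_j x_j` is nil. [folklore] -/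
theorem isNil_sigma : (∑ j : Fin (n + 1), single ({j} : Finset (Fin (n + 1))) (1 : ℝ)).IsNil :=
  isNil_sum fun j _ => isNil_single' (singleton_nonempty j) _

/-- **The product for the OR-shape family**: `∏_ω (1 − L_V(ω))^{μ_p(ω)} = Ĝ · (1−σ)^{p_e}`,
`Ĝ = ∏_ω (1 − X_ω)^{(1−p_e)·μ_{p[e↦0]}(ω)}`. [this work] -/
theorem prod_binomB_orTail :
    ∏ ω, binomB (bernoulliWeight p ω) (lin (fun j => ind (B j ∪ {ω' : Set ι | e ∈ ω'})) ω) =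
      (∏ ω, binomB ((1 - (p e : ℝ)) * bernoulliWeight (update p e 0) ω) (lin (fun j => ind (B j)) ω)) *
        binomB (p e : ℝ) (∑ j : Fin (n + 1), single ({j} : Finset (Fin (n + 1))) (1 : ℝ)) := by
  have hsplit : ∀ ω ∈ (univ : Finset (Set ι)),
      binomB (bernoulliWeight p ω) (lin (fun j => ind (B j ∪ {ω' : Set ι | e ∈ ω'})) ω) =
        binomB ((1 - (p e : ℝ)) * bernoulliWeight (update p e 0) ω) (lin (fun j => ind (B j)) ω) *
          binomB ((p e : ℝ) * bernoulliWeight (update p e 1) ω) (∑ j : Fin (n + 1), single ({j} : Finset (Fin (n + 1))) (1 : ℝ)) := by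
    intro ω _
    rw [bernoulliWeight_eq_sections p e ω, ← binomB_mul_same (isNil_lin _ ω)]
    by_cases he : e ∈ ω
    · rw [bernoulliWeight_update_zero_eq_zero p e he, mul_zero, binomB_zero_left', binomB_zero_left', one_mul, one_mul,
        lin_orTail_of_mem e B he]
    · rw [bernoulliWeight_update_one_eq_zero p e he, mul_zero, binomB_zero_left', binomB_zero_left', mul_one, mul_one,
        lin_orTail_of_not_mem e B he]
  rw [Finset.prod_congr rfl hsplit, Finset.prod_mul_distrib, prod_binomB_same _ _ (isNil_sigma (n := n)),
    ← Finset.mul_sum, sum_bernoulliWeight, mul_one]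

/-- **Sahi's functional of the OR-shape family as a top square-free coefficient** (every order; `A`, `B_j` any events — only the
values of `1_{B_j}` off `e` enter):
`E_{n+2}(μ_p; 1_A, (1_{B_j ∪ S_e})_j) = [x^{univ}] Ĝ·(1−σ)^t·( s·Σ_ω μ⁰(ω)1_{A⁰}(ω)(1−X_ω)⁻¹ + t·μ_p(A¹)·(1−σ)⁻¹ )`.
[this work] -/
theorem sahiE_orShape_eq_coeff :
    sahiE (bernoulliWeight p) (n + 2) (Matrix.vecCons (ind A) (fun j => ind (B j ∪ {ω' : Set ι | e ∈ ω'}))) =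
      ((∏ ω, binomB ((1 - (p e : ℝ)) * bernoulliWeight (update p e 0) ω) (lin (fun j => ind (B j)) ω)) *
          binomB (p e : ℝ) (∑ j : Fin (n + 1), single ({j} : Finset (Fin (n + 1))) (1 : ℝ)) *
        (C (1 - (p e : ℝ)) * ∑ ω, C (bernoulliWeight (update p e 0) ω * ind (secAt e false A) ω) * inv1 (lin (fun j => ind (B j)) ω) +
          C ((p e : ℝ) * ex (bernoulliWeight p) (ind (secAt e true A))) *
            inv1 (∑ j : Fin (n + 1), single ({j} : Finset (Fin (n + 1))) (1 : ℝ)))).coeff univ := by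
  rw [sahiE_cons_eq_sum_coeff _ (sum_bernoulliWeight p), prod_binomB_orTail p e B]
  set Zf := (∏ ω, binomB ((1 - (p e : ℝ)) * bernoulliWeight (update p e 0) ω) (lin (fun j => ind (B j)) ω)) *
      binomB (p e : ℝ) (∑ j : Fin (n + 1), single ({j} : Finset (Fin (n + 1))) (1 : ℝ)) with hZf
  set σ : SqFree (Fin (n + 1)) ℝ := ∑ j : Fin (n + 1), single ({j} : Finset (Fin (n + 1))) (1 : ℝ) with hσ
  set a1 : ℝ := ex (bernoulliWeight p) (ind (secAt e true A)) with ha1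
  -- split each summand along `μ_p = s μ⁰ + t μ¹`
  have hterm : ∀ ω ∈ (univ : Finset (Set ι)),
      bernoulliWeight p ω * ind A ω * (Zf * inv1 (lin (fun j => ind (B j ∪ {ω' : Set ι | e ∈ ω'})) ω)).coeff univ =
        (1 - (p e : ℝ)) * (bernoulliWeight (update p e 0) ω * ind (secAt e false A) ω *
            (Zf * inv1 (lin (fun j => ind (B j)) ω)).coeff univ) +
          (p e : ℝ) * (bernoulliWeight (update p e 1) ω * ind (secAt e true A) ω) * (Zf * inv1 σ).coeff univ := by
    intro ω _
    rw [bernoulliWeight_eq_sections p e ω]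
    by_cases he : e ∈ ω
    · rw [bernoulliWeight_update_zero_eq_zero p e he, lin_orTail_of_mem e B he, ← SahiComb.ind_secAt_true_of_mem e A he]
      ring
    · rw [bernoulliWeight_update_one_eq_zero p e he, lin_orTail_of_not_mem e B he, ← SahiComb.ind_secAt_false_of_notMem e A he]
      ring
  have hsum1 : ∑ ω, (1 - (p e : ℝ)) * (bernoulliWeight (update p e 0) ω * ind (secAt e false A) ω *
        (Zf * inv1 (lin (fun j => ind (B j)) ω)).coeff univ) =
      (1 - (p e : ℝ)) * ∑ ω, bernoulliWeight (update p e 0) ω * ind (secAt e false A) ω *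
        (Zf * inv1 (lin (fun j => ind (B j)) ω)).coeff univ := by
    rw [Finset.mul_sum]
  have hsum2 : ∑ ω, (p e : ℝ) * (bernoulliWeight (update p e 1) ω * ind (secAt e true A) ω) * (Zf * inv1 σ).coeff univ =
      (p e : ℝ) * a1 * (Zf * inv1 σ).coeff univ := by
    have ha : ∑ ω, bernoulliWeight (update p e 1) ω * ind (secAt e true A) ω = a1 := by
      rw [ha1, ← ex_ind_secAt_update p e true A 1, ex_def]
    rw [← ha, Finset.mul_sum, Finset.sum_mul]
  rw [Finset.sum_congr rfl hterm, Finset.sum_add_distrib, hsum1, hsum2]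
  -- the right-hand side, expanded
  have hre : Zf * (C (1 - (p e : ℝ)) * ∑ ω, C (bernoulliWeight (update p e 0) ω * ind (secAt e false A) ω) *
        inv1 (lin (fun j => ind (B j)) ω) + C ((p e : ℝ) * a1) * inv1 σ) =
      C (1 - (p e : ℝ)) * (∑ ω, C (bernoulliWeight (update p e 0) ω * ind (secAt e false A) ω) *
        (Zf * inv1 (lin (fun j => ind (B j)) ω))) + C ((p e : ℝ) * a1) * (Zf * inv1 σ) := by
    have h1 : Zf * (∑ ω, C (bernoulliWeight (update p e 0) ω * ind (secAt e false A) ω) * inv1 (lin (fun j => ind (B j)) ω)) =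
        ∑ ω, C (bernoulliWeight (update p e 0) ω * ind (secAt e false A) ω) * (Zf * inv1 (lin (fun j => ind (B j)) ω)) := by
      rw [Finset.mul_sum]
      exact Finset.sum_congr rfl fun ω _ => by ring
    rw [mul_add, ← mul_assoc, mul_comm Zf (C (1 - (p e : ℝ))), mul_assoc, h1]
    ring
  rw [hre, coeff_add, coeff_C_mul', coeff_C_mul', coeff_sum']
  congr 1
  congr 1
  exact Finset.sum_congr rfl fun ω _ => by rw [coeff_C_mul']

end OrFamily

end OrShape
end Summit.CriticalPhenomena.PercolationContinuityZ3.Theorems
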